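import Summits.CriticalPhenomena.SAWScalingLimit.Theorems.HexTight.Negative.LatticeG2Ring

/-!
# Ring counterexample to lattice G2 for crux `HexTight` (stmt-CriticalPhenomena-5423), part 3:
`LatticeJoined` API, separation of the two arms, the two routes round the ring

`LatticeJoined S` (verbatim from the line) is an equivalence-like relation built from lattice paths
inside `S`; a path inside a set whose cells have real part `≥ Re x + 1/2` or `≤ Re x - 1/2` never
changes side (`re_pos_of_latticeJoined`, `re_neg_of_latticeJoined`); and the centre cell `U(0,0)`
is joined to the far cell `U(0,2K)` both inside the right half `Tpos` (bottom row rightwards, right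
column, top row) and inside `Tneg` (bottom row leftwards, left column, top row). Used by
`Negative/LatticeG2False.lean`.
-/

noncomputable section

open scoped BigOperators
open Classical
open Literature.Probability.LatticeModels
open Literature.Probability.RandomPlanarGeometry.SAW

namespace Summit.CriticalPhenomena.SAWScalingLimit.Cruxes.HexTight.Negative

/-! ## `LatticeJoined` API -/

section Joined

variable {S T : Set HexVertex} {u v w : HexVertex}

/-- the start of a joining path lies in `S` -/
theorem LatticeJoined.mem_left (h : LatticeJoined S u w) : u ∈ S := by
  obtain ⟨p, hp⟩ := h; exact hp _ p.start_mem_support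

/-- the end of a joining path lies in `S` -/
theorem LatticeJoined.mem_right (h : LatticeJoined S u w) : w ∈ S := by
  obtain ⟨p, hp⟩ := h; exact hp _ p.end_mem_support

/-- reflexivity inside `S` -/
theorem latticeJoined_refl (hu : u ∈ S) : LatticeJoined S u u :=
  ⟨SimpleGraph.Walk.nil, by simpa using hu⟩

/-- transitivity (concatenation of paths) -/
theorem LatticeJoined.trans (h₁ : LatticeJoined S u v) (h₂ : LatticeJoined S v w) :
    LatticeJoined S u w := by
  obtain ⟨p, hp⟩ := h₁
  obtain ⟨p', hp'⟩ := h₂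
  refine ⟨p.append p', fun y hy => ?_⟩
  rw [SimpleGraph.Walk.support_append, List.mem_append] at hy
  rcases hy with hy | hy
  · exact hp y hy
  · exact hp' y (List.tail_subset _ hy)

/-- extension by one edge inside `S` -/
theorem LatticeJoined.step (h : LatticeJoined S u v) (hvw : hexGraph.Adj v w) (hw : w ∈ S) :
    LatticeJoined S u w := by
  refine h.trans ⟨SimpleGraph.Walk.cons hvw SimpleGraph.Walk.nil, fun y hy => ?_⟩
  simp only [SimpleGraph.Walk.support_cons, SimpleGraph.Walk.support_nil, List.mem_cons,
    List.not_mem_nil, or_false] at hy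
  rcases hy with rfl | rfl
  · exact h.mem_right
  · exact hw

/-- monotonicity in the set -/
theorem LatticeJoined.mono (hST : S ⊆ T) (h : LatticeJoined S u w) : LatticeJoined T u w := by
  obtain ⟨p, hp⟩ := h; exact ⟨p, fun y hy => hST (hp y hy)⟩

/-- `u` and `w` are joined inside `S` by a lattice path of length at most `L` (length bookkeeping
for `LatticeJoined`, used downstream to bound the number of vertices of the right route). -/
def JoinedLen (S : Set HexVertex) (u w : HexVertex) (L : ℕ) : Prop :=
  ∃ p : hexGraph.Walk u w, p.length ≤ L ∧ ∀ y ∈ p.support, y ∈ S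

/-- forgetting the length -/
theorem JoinedLen.latticeJoined {L : ℕ} (h : JoinedLen S u w L) : LatticeJoined S u w := by
  obtain ⟨p, -, hp⟩ := h; exact ⟨p, hp⟩

/-- the end of a bounded joining path lies in `S` -/
theorem JoinedLen.mem_right {L : ℕ} (h : JoinedLen S u w L) : w ∈ S :=
  h.latticeJoined.mem_right

/-- reflexivity, length `0` -/
theorem joinedLen_refl (hu : u ∈ S) : JoinedLen S u u 0 :=
  ⟨SimpleGraph.Walk.nil, le_rfl, by simpa using hu⟩

/-- transitivity, lengths add -/
theorem JoinedLen.trans {L L' : ℕ} (h₁ : JoinedLen S u v L) (h₂ : JoinedLen S v w L') :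
    JoinedLen S u w (L + L') := by
  obtain ⟨p, hpL, hp⟩ := h₁
  obtain ⟨p', hpL', hp'⟩ := h₂
  refine ⟨p.append p', ?_, fun y hy => ?_⟩
  · rw [SimpleGraph.Walk.length_append]; omega
  · rw [SimpleGraph.Walk.support_append, List.mem_append] at hy
    rcases hy with hy | hy
    · exact hp y hy
    · exact hp' y (List.tail_subset _ hy)

/-- extension by one edge inside `S`, length `+ 1` -/
theorem JoinedLen.step {L : ℕ} (h : JoinedLen S u v L) (hvw : hexGraph.Adj v w) (hw : w ∈ S) :
    JoinedLen S u w (L + 1) := by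
  refine h.trans ⟨SimpleGraph.Walk.cons hvw SimpleGraph.Walk.nil, by simp, fun y hy => ?_⟩
  simp only [SimpleGraph.Walk.support_cons, SimpleGraph.Walk.support_nil, List.mem_cons,
    List.not_mem_nil, or_false] at hy
  rcases hy with rfl | rfl
  · exact h.mem_right
  · exact hw

/-- monotonicity in the length bound -/
theorem JoinedLen.of_le {L L' : ℕ} (h : JoinedLen S u w L) (hL : L ≤ L') : JoinedLen S u w L' := by
  obtain ⟨p, hpL, hp⟩ := h; exact ⟨p, hpL.trans hL, hp⟩

/-- A chain of adjacent cells inside `S` joins its head to each of its members inside `S`. -/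
theorem latticeJoined_of_isChain : ∀ (a : HexVertex) (m : List HexVertex),
    (a :: m).IsChain hexGraph.Adj → (∀ y ∈ a :: m, y ∈ S) → ∀ y ∈ a :: m, LatticeJoined S a y
  | a, [], _, hS, y, hy => by
    rw [List.mem_singleton] at hy
    subst hy
    exact latticeJoined_refl (hS _ (by simp))
  | a, b :: m, hch, hS, y, hy => by
    rw [List.isChain_cons_cons] at hch
    have ha : a ∈ S := hS _ (by simp)
    rcases List.mem_cons.1 hy with rfl | hy
    · exact latticeJoined_refl ha
    · have hb : LatticeJoined S a b :=
        (latticeJoined_refl ha).step hch.1 (hS _ (List.mem_cons_of_mem _ (by simp)))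
      exact hb.trans (latticeJoined_of_isChain b m hch.2
        (fun z hz => hS z (List.mem_cons_of_mem _ hz)) y hy)

/-- **Separation.** If every cell of `S` has real part `≥ Re x + 1/2` or `≤ Re x - 1/2`, a lattice
path inside `S` never changes side (adjacent cells differ by `≤ 1/2` in real part). -/
theorem re_pos_of_latticeJoined
    (hS : ∀ y ∈ S, x₀.re + 1 / 2 ≤ (hexCenter y).re ∨ (hexCenter y).re ≤ x₀.re - 1 / 2)
    (h : LatticeJoined S u w) (hu : x₀.re < (hexCenter u).re) : x₀.re < (hexCenter w).re := by
  obtain ⟨p, hp⟩ := h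
  induction p with
  | nil => exact hu
  | @cons a b _ hab p ih =>
    refine ih ?_ (fun y hy => hp y (List.mem_cons_of_mem _ hy))
    have ha := hS a (hp a (by simp))
    have hb := hS b (hp b (List.mem_cons_of_mem _ p.start_mem_support))
    have hd := (re_sub_re_of_adj hab).1
    rw [abs_le] at hd
    rcases ha with ha | ha
    · rcases hb with hb | hb <;> linarith
    · linarith

/-- **Separation**, left side: symmetric statement. -/
theorem re_neg_of_latticeJoined
    (hS : ∀ y ∈ S, x₀.re + 1 / 2 ≤ (hexCenter y).re ∨ (hexCenter y).re ≤ x₀.re - 1 / 2)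
    (h : LatticeJoined S u w) (hu : (hexCenter u).re < x₀.re) : (hexCenter w).re < x₀.re := by
  obtain ⟨p, hp⟩ := h
  induction p with
  | nil => exact hu
  | @cons a b _ hab p ih =>
    refine ih ?_ (fun y hy => hp y (List.mem_cons_of_mem _ hy))
    have ha := hS a (hp a (by simp))
    have hb := hS b (hp b (List.mem_cons_of_mem _ p.start_mem_support))
    have hd := (re_sub_re_of_adj hab).1
    rw [abs_le] at hd
    rcases ha with ha | ha
    · linarith
    · rcases hb with hb | hb <;> linarith

end Joined

/-! ## The two routes round the ring -/

/-- the right half: ring cells with real part `≥ Re x` -/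
def Tpos (K : ℕ) : Set HexVertex := {y | y ∈ ring K ∧ x₀.re ≤ (hexCenter y).re}

/-- the left route's cells: ring cells with real part `≤ Re x`, or on the top row -/
def Tneg (K : ℕ) : Set HexVertex := {y | y ∈ ring K ∧ ((hexCenter y).re ≤ x₀.re ∨ y.1 1 = 2 * K)}

section Routes

variable {K : ℕ} (hK : 1 ≤ K)
include hK

/-- right route, bottom: `U(0,0) → D(0,0) → U(1,0) → ⋯ → U(n,0)`, `2n` steps -/
theorem joined_right_bottom : ∀ n : ℕ, (n : ℤ) ≤ K → JoinedLen (Tpos K) (U 0 0) (U n 0) (2 * n)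
  | 0, _ => by
    refine joinedLen_refl ⟨U_mem_ring.2 (Or.inl ⟨rfl, by omega, by omega⟩), ?_⟩
    exact le_of_eq rfl
  | n + 1, hn => by
    have h1 : JoinedLen (Tpos K) (U 0 0) (U n 0) (2 * n) :=
      joined_right_bottom n (by push_cast at hn; omega)
    have h2 : JoinedLen (Tpos K) (U 0 0) (D n 0) (2 * n + 1) := by
      refine h1.step (adj_U_D _ _) ⟨D_mem_ring.2 (Or.inl ⟨rfl, by omega, by push_cast at hn; omega⟩), ?_⟩
      show x₀.re ≤ _
      rw [x₀_re, re_D]; push_cast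
      have : (0 : ℝ) ≤ n := Nat.cast_nonneg _
      linarith
    have h3 := h2.step (adj_D_Ur _ _) ⟨U_mem_ring.2 (Or.inl ⟨rfl, by omega, by push_cast at hn ⊢; omega⟩), by
      show x₀.re ≤ _
      rw [x₀_re, re_U]; push_cast
      have : (0 : ℝ) ≤ n := Nat.cast_nonneg _
      linarith⟩
    push_cast
    rw [show 2 * (n + 1) = 2 * n + 1 + 1 by ring]
    exact h3

/-- right route, right column: `U(K,0) → D(K,0) → U(K,1) → ⋯ → U(K,m)`, `2m` steps -/
theorem joined_right_col : ∀ m : ℕ, m ≤ 2 * K → JoinedLen (Tpos K) (U K 0) (U K m) (2 * m)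
  | 0, _ => by
    refine joinedLen_refl ⟨U_mem_ring.2 (Or.inl ⟨rfl, by omega, le_rfl⟩), ?_⟩
    show x₀.re ≤ _
    rw [x₀_re, re_U]; push_cast
    have : (0 : ℝ) ≤ K := Nat.cast_nonneg _
    linarith
  | m + 1, hm => by
    have h1 : JoinedLen (Tpos K) (U K 0) (U K m) (2 * m) := joined_right_col m (by omega)
    have hK0 : (0 : ℝ) ≤ K := Nat.cast_nonneg _
    have hm0 : (0 : ℝ) ≤ m := Nat.cast_nonneg _
    have hD : D (K : ℤ) (m : ℤ) ∈ ring K := by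
      rcases Nat.eq_zero_or_pos m with rfl | hmpos
      · exact D_mem_ring.2 (Or.inl ⟨by simp, by omega, le_rfl⟩)
      · exact D_mem_ring.2 (Or.inr (Or.inl ⟨rfl, by exact_mod_cast hmpos, by omega⟩))
    have h2 : JoinedLen (Tpos K) (U K 0) (D K m) (2 * m + 1) := by
      refine h1.step (adj_U_D _ _) ⟨hD, ?_⟩
      show x₀.re ≤ _
      rw [x₀_re, re_D]; push_cast; linarith
    have h3 := h2.step (adj_D_Uu _ _) ⟨U_mem_ring.2 (Or.inr (Or.inl ⟨rfl, by omega, by omega⟩)), by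
      show x₀.re ≤ _
      rw [x₀_re, re_U]; push_cast; linarith⟩
    push_cast
    rw [show 2 * (m + 1) = 2 * m + 1 + 1 by ring]
    exact h3

/-- right route, top row leftwards: `U(K,2K) → D(K-1,2K) → ⋯ → U(K-n,2K)`, `2n` steps -/
theorem joined_right_top : ∀ n : ℕ, n ≤ K →
    JoinedLen (Tpos K) (U K (2 * K)) (U ((K : ℤ) - n) (2 * K)) (2 * n)
  | 0, _ => by
    have h := joined_right_col hK (2 * K) le_rfl
    push_cast at h
    simpa using joinedLen_refl h.mem_right
  | n + 1, hn => by
    have h1 := joined_right_top n (by omega)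
    have hK0 : (0 : ℝ) ≤ K := Nat.cast_nonneg _
    have hn' : (n : ℝ) + 1 ≤ K := by exact_mod_cast hn
    have h2 : JoinedLen (Tpos K) (U K (2 * K)) (D ((K : ℤ) - n - 1) (2 * K)) (2 * n + 1) := by
      refine h1.step (adj_U_Dl _ _) ⟨D_mem_ring.2 (Or.inr (Or.inr (Or.inl ⟨rfl, by omega, by omega⟩))), ?_⟩
      show x₀.re ≤ _
      rw [x₀_re, re_D]; push_cast; linarith
    have h3 := h2.step (adj_U_D _ _).symm
      ⟨U_mem_ring.2 (Or.inr (Or.inr (Or.inl ⟨rfl, by omega, by omega⟩))), by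
        show x₀.re ≤ _
        rw [x₀_re, re_U]; push_cast; linarith⟩
    push_cast
    rw [show (K : ℤ) - (n + 1) = K - n - 1 by ring, show 2 * (n + 1) = 2 * n + 1 + 1 by ring]
    exact h3

/-- **The right route** `U(0,0) → ⋯ → U(0,2K)` inside `Tpos`, of length `≤ 8K`. -/
theorem joined_rightLen : JoinedLen (Tpos K) (U 0 0) (U 0 (2 * K)) (8 * K) := by
  have h1 := joined_right_bottom hK K le_rfl
  have h2 := joined_right_col hK (2 * K) le_rfl
  have h3 := joined_right_top hK K le_rfl
  push_cast at h2 h3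
  rw [sub_self] at h3
  exact ((h1.trans h2).trans h3).of_le (by omega)

/-- **The right route** `U(0,0) → ⋯ → U(0,2K)` inside `Tpos`. -/
theorem joined_right : LatticeJoined (Tpos K) (U 0 0) (U 0 (2 * K)) :=
  (joined_rightLen hK).latticeJoined

/-- left route, bottom leftwards: `U(0,0) → D(-1,0) → U(-1,0) → ⋯ → D(-n-1,0)` -/
theorem joined_left_bottom : ∀ n : ℕ, (n : ℤ) + 1 ≤ 3 * K →
    LatticeJoined (Tneg K) (U 0 0) (D (-(n : ℤ) - 1) 0)
  | 0, _ => by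
    have h0 : LatticeJoined (Tneg K) (U 0 0) (U 0 0) := by
      refine latticeJoined_refl ⟨U_mem_ring.2 (Or.inl ⟨rfl, by omega, by omega⟩), Or.inl ?_⟩
      exact le_of_eq rfl
    have h1 := h0.step (adj_U_Dl 0 0) ⟨D_mem_ring.2 (Or.inl ⟨rfl, by omega, by omega⟩), Or.inl (by
      rw [x₀_re, re_D]; push_cast; linarith)⟩
    simpa using h1
  | n + 1, hn => by
    push_cast at hn
    have h1 := joined_left_bottom n (by omega)
    have hn0 : (0 : ℝ) ≤ n := Nat.cast_nonneg _
    have h2 : LatticeJoined (Tneg K) (U 0 0) (U (-(n : ℤ) - 1) 0) := by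
      refine h1.step (adj_U_D _ _).symm ⟨U_mem_ring.2 (Or.inl ⟨rfl, by omega, by omega⟩), Or.inl ?_⟩
      rw [x₀_re, re_U]; push_cast; linarith
    have h3 := h2.step (adj_U_Dl _ _) ⟨D_mem_ring.2 (Or.inl ⟨rfl, by omega, by omega⟩), Or.inl (by
      rw [x₀_re, re_D]; push_cast; linarith)⟩
    push_cast
    rw [show -((n : ℤ) + 1) - 1 = -(n : ℤ) - 1 - 1 by ring]
    exact h3

/-- `U(-3K, j)` is a ring cell for `1 ≤ j ≤ 2K` (left column, or the top-left corner). -/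
theorem U_left_mem {j : ℤ} (h1 : 1 ≤ j) (h2 : j ≤ 2 * K) : U (-(3 * K : ℤ)) j ∈ ring K := by
  rcases lt_or_eq_of_le h2 with h | h
  · exact U_mem_ring.2 (Or.inr (Or.inr (Or.inr ⟨rfl, h1, by omega⟩)))
  · exact U_mem_ring.2 (Or.inr (Or.inr (Or.inl ⟨h, le_rfl, by omega⟩)))

/-- left route, left column upwards: `D(-3K,0) → U(-3K,1) → D(-3K,1) → ⋯ → U(-3K,m+1)` -/
theorem joined_left_col : ∀ m : ℕ, m + 1 ≤ 2 * K →
    LatticeJoined (Tneg K) (D (-(3 * K : ℤ)) 0) (U (-(3 * K : ℤ)) (m + 1))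
  | 0, hm => by
    have hK0 : (1 : ℝ) ≤ K := by exact_mod_cast hK
    have h0 : LatticeJoined (Tneg K) (D (-(3 * K : ℤ)) 0) (D (-(3 * K : ℤ)) 0) := by
      refine latticeJoined_refl ⟨D_mem_ring.2 (Or.inl ⟨rfl, le_rfl, by omega⟩), Or.inl ?_⟩
      rw [x₀_re, re_D]; push_cast; linarith
    have h1 := h0.step (adj_D_Uu _ _) ⟨U_left_mem hK (by norm_num) (by omega), Or.inl (by
      rw [x₀_re, re_U]; push_cast; linarith)⟩
    simpa using h1
  | m + 1, hm => by
    have h1 := joined_left_col m (by omega)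
    have hK0 : (1 : ℝ) ≤ K := by exact_mod_cast hK
    have hm' : (m : ℝ) + 1 + 1 ≤ 2 * K := by exact_mod_cast hm
    have h2 : LatticeJoined (Tneg K) (D (-(3 * K : ℤ)) 0) (D (-(3 * K : ℤ)) (m + 1)) := by
      refine h1.step (adj_U_D _ _) ⟨D_mem_ring.2 (Or.inr (Or.inr (Or.inr ⟨rfl, by omega, by omega⟩))),
        Or.inl ?_⟩
      rw [x₀_re, re_D]; push_cast; linarith
    have h3 := h2.step (adj_D_Uu _ _) ⟨U_left_mem hK (by omega) (by omega), Or.inl (by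
      rw [x₀_re, re_U]; push_cast; linarith)⟩
    push_cast
    exact h3

/-- left route, top row rightwards: `U(-3K,2K) → D(-3K,2K) → U(-3K+1,2K) → ⋯ → U(-3K+n,2K)` -/
theorem joined_left_top : ∀ n : ℕ, n ≤ 3 * K →
    LatticeJoined (Tneg K) (U (-(3 * K : ℤ)) (2 * K)) (U (-(3 * K : ℤ) + n) (2 * K))
  | 0, _ => by
    simpa using latticeJoined_refl (S := Tneg K)
      ⟨U_left_mem hK (by omega) le_rfl, Or.inr rfl⟩
  | n + 1, hn => by
    have h1 := joined_left_top n (by omega)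
    have h2 : LatticeJoined (Tneg K) (U (-(3 * K : ℤ)) (2 * K)) (D (-(3 * K : ℤ) + n) (2 * K)) :=
      h1.step (adj_U_D _ _) ⟨D_mem_ring.2 (Or.inr (Or.inr (Or.inl ⟨rfl, by omega, by omega⟩))), Or.inr rfl⟩
    have h3 := h2.step (adj_D_Ur _ _)
      ⟨U_mem_ring.2 (Or.inr (Or.inr (Or.inl ⟨rfl, by omega, by omega⟩))), Or.inr rfl⟩
    push_cast
    rw [show -(3 * (K : ℤ)) + (n + 1) = -(3 * K) + n + 1 by ring]
    exact h3

/-- **The left route** `U(0,0) → ⋯ → U(0,2K)` inside `Tneg`. -/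
theorem joined_left : LatticeJoined (Tneg K) (U 0 0) (U 0 (2 * K)) := by
  obtain ⟨n₁, hn₁⟩ : ∃ n : ℕ, (n : ℤ) = 3 * K - 1 := ⟨3 * K - 1, by omega⟩
  obtain ⟨n₂, hn₂⟩ : ∃ n : ℕ, (n : ℤ) = 2 * K - 1 := ⟨2 * K - 1, by omega⟩
  have h1 := joined_left_bottom hK n₁ (by omega)
  have h2 := joined_left_col hK n₂ (by omega)
  have h3 := joined_left_top hK (3 * K) le_rfl
  rw [hn₁, show -(3 * (K : ℤ) - 1) - 1 = -(3 * K) by ring] at h1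
  rw [hn₂, sub_add_cancel] at h2
  push_cast at h3
  rw [neg_add_cancel] at h3
  exact (h1.trans h2).trans h3

end Routes

end Summit.CriticalPhenomena.SAWScalingLimit.Cruxes.HexTight.Negative

end
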